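import Summits.AtomisticToContinuum.BoseEinsteinCondensation.Theorems.BECGroundStateSOSBoundaryTransferWeakHardWallLimitChain

/-!
# Route `BECGroundStateSOS`, crux `BoundaryTransferWeak` (stmt-AtomisticToContinuum-0827),
# line `rim-squeeze-monotone-coherence`: stub (L) `stub_hardWallLimit` for BOUNDED pair potentials

Supports (does not close) stmt-AtomisticToContinuum-0827; final auxiliary block of the registered
stub `stub_hardWallLimit` (L) (lead c3). The transfer chain `transfer_chain`
(`…HardWallLimitChain.lean`: rim-layer cut-off, `2h`-translation, shrink of the fattened cube) has
all its error terms polynomial (and square roots of polynomials) in ONE small parameter `h`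
once the rim-mass ceiling is tied to it (`μr = h³`, which also tames the cut-off slope
`D² μr = 12c₀² h`), so they tend to `0` with `h` (`exists_hardWall_params`, a continuity argument
at `h = 0`). Consequently:

* `hardWallTransfer_of_bounded` — **near-minimiser transfer across the hard wall** for every
  repulsive finite-range `v` that is BOUNDED (`v ≤ M < ⊤`), at every density, eventually in `N`
  (exactly the third hypothesis of `stub_hardWallLimit_aux`);
* `stub_hardWallLimit_bounded` — **stub (L) for bounded pair potentials**: the registered statement
  of `stub_hardWallLimit` with the single extra hypothesis `∃ M ≠ ⊤, ∀ r, v r ≤ M`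
  (`stub_hardWallLimit_aux` + the transfer; Dirichlet rigidity and finiteness come from stmt-9072).

What separates this from the registered (L): for `v` unbounded at `r → 0` the shrink step needs a
pair-collision cut-off before dilating (stmt-9072's `stub_pairCutoff`/`stub_truncHigh` machinery);
for hard cores (`v = ⊤` near `0`) dilation is unavailable and Dirichlet uniqueness is conditional.
All `[folklore]`.
-/

noncomputable section

namespace Summit.AtomisticToContinuum.BoseEinsteinCondensation.RimSqueeze

open Literature.MathematicalPhysics.QuantumManyBody.BoseGas
open MeasureTheory Filter Set Topology
open scoped ENNReal NNReal ComplexConjugate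
open Summit.AtomisticToContinuum.BoseEinsteinCondensation.Theorems.GroundStateRigidity
  (groundStateEnergy_ne_top_of_locBdd)

variable {N : ℕ}

/-- **Choice of the small parameter.** For `0 < d ≤ 1 ≤ K`, `ε > 0`, some `h ∈ (0, min(L/16, 1/2)]`
makes the energy error of the transfer chain `< d` and its distance error `< ε` (all error terms
are continuous in `h` and vanish, up to `ηK + (1+η)δr = d/16 + (1 + d/(16K)) d/4 < d`, at `h = 0`).
[folklore] -/
theorem exists_hardWall_params (N : ℕ) {L K c₀ d ε : ℝ} (Mr : ℝ) (hL : 0 < L) (hK : 1 ≤ K)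
    (hd : 0 < d) (hd1 : d ≤ 1) (hε : 0 < ε) :
    ∃ h : ℝ, 0 < h ∧ 16 * h < L ∧ h ≤ 1 / 2 ∧
      ∀ η δr σ a₁ p₁ q₁ k₁ b₃ b₂ : ℝ, η = d / (16 * K) → δr = d / 4 → σ = 1 + 8 * h / L →
        a₁ = 1 + 2 * h ^ 3 → p₁ = a₁ * (1 + η) → q₁ = a₁ * (1 + η⁻¹) * (12 * c₀ ^ 2 * h) →
        k₁ = p₁ * K + q₁ →
        b₃ = 6 * N * (σ - 1) + 18 * N * (σ - 1) ^ 2 * (L / 2 + 4 * h) ^ 2 * k₁ →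
        b₂ = 36 * N * h ^ 2 * K →
        (σ ^ 2 * p₁ - 1) * K + σ ^ 2 * p₁ * δr + σ ^ 2 * q₁ + 2 * (N * N) * Mr * Real.sqrt b₃ < d ∧
        (Real.sqrt b₃ + Real.sqrt (4 * h ^ 3) + Real.sqrt b₂) ^ 2 < ε := by
  set η : ℝ := d / (16 * K) with hη
  set δr : ℝ := d / 4 with hδr
  -- the error terms as functions of `h`
  set F : ℝ → ℝ := fun h =>
    ((1 + 8 * h / L) ^ 2 * ((1 + 2 * h ^ 3) * (1 + η)) - 1) * K +
      (1 + 8 * h / L) ^ 2 * ((1 + 2 * h ^ 3) * (1 + η)) * δr +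
      (1 + 8 * h / L) ^ 2 * ((1 + 2 * h ^ 3) * (1 + η⁻¹) * (12 * c₀ ^ 2 * h)) +
      2 * (N * N) * Mr * Real.sqrt (6 * N * (1 + 8 * h / L - 1) +
        18 * N * (1 + 8 * h / L - 1) ^ 2 * (L / 2 + 4 * h) ^ 2 *
          ((1 + 2 * h ^ 3) * (1 + η) * K + (1 + 2 * h ^ 3) * (1 + η⁻¹) * (12 * c₀ ^ 2 * h)))
    with hF
  set G : ℝ → ℝ := fun h =>
    (Real.sqrt (6 * N * (1 + 8 * h / L - 1) +
        18 * N * (1 + 8 * h / L - 1) ^ 2 * (L / 2 + 4 * h) ^ 2 *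
          ((1 + 2 * h ^ 3) * (1 + η) * K + (1 + 2 * h ^ 3) * (1 + η⁻¹) * (12 * c₀ ^ 2 * h))) +
      Real.sqrt (4 * h ^ 3) + Real.sqrt (36 * N * h ^ 2 * K)) ^ 2 with hG
  have hFc : Continuous F := by
    rw [hF]
    fun_prop
  have hGc : Continuous G := by
    rw [hG]
    fun_prop
  have hF0 : F 0 < d := by
    have e : F 0 = η * K + (1 + η) * δr := by
      rw [hF]
      simp
    rw [e, hη, hδr]
    have hK0 : 0 < K := by linarith
    have h1 : d / (16 * K) * K = d / 16 := by field_simp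
    have h2 : d / (16 * K) ≤ 1 / 16 := by
      rw [div_le_div_iff₀ (by positivity) (by norm_num)]
      nlinarith
    rw [h1]
    nlinarith
  have hG0 : G 0 < ε := by
    have e : G 0 = 0 := by
      rw [hG]
      simp
    rwa [e]
  -- eventually near `0⁺` all constraints hold
  have hr : 0 < min (L / 16) (1 / 2) := lt_min (by positivity) (by norm_num)
  have hev : ∀ᶠ h in 𝓝[>] (0 : ℝ), F h < d ∧ G h < ε ∧ h ∈ Ioo 0 (min (L / 16) (1 / 2)) := by
    have h1 : ∀ᶠ h in 𝓝 (0 : ℝ), F h < d := (hFc.tendsto 0).eventually_lt_const hF0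
    have h2 : ∀ᶠ h in 𝓝 (0 : ℝ), G h < ε := (hGc.tendsto 0).eventually_lt_const hG0
    exact (((h1.and h2).filter_mono nhdsWithin_le_nhds).and (Ioo_mem_nhdsGT hr)).mono
      fun x hx => ⟨hx.1.1, hx.1.2, hx.2⟩
  obtain ⟨h, hFh, hGh, hh0, hhr⟩ := hev.exists
  have hhL : h < L / 16 := hhr.trans_le (min_le_left _ _)
  have hh2 : h < 1 / 2 := hhr.trans_le (min_le_right _ _)
  refine ⟨h, hh0, by linarith, hh2.le, ?_⟩
  rintro η' δr' σ a₁ p₁ q₁ k₁ b₃ b₂ rfl rfl rfl rfl rfl rfl rfl rfl rfl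
  exact ⟨hFh, hGh⟩

/-- A bounded potential is locally bounded on `(0, ∞)` (both forms used by the tree). [folklore] -/
theorem locBdd_of_bounded {v : ℝ → ℝ≥0∞} (hb : ∃ M : ℝ≥0∞, M ≠ ⊤ ∧ ∀ r : ℝ, v r ≤ M) :
    (∀ δ : ℝ, 0 < δ → ∃ M : ℝ≥0∞, M ≠ ⊤ ∧ ∀ r : ℝ, δ < r → v r ≤ M) ∧
      ∀ r : ℝ, 0 < r → ∃ C : ℝ≥0, ∀ s : ℝ, r ≤ s → v s ≤ C := by
  obtain ⟨M, hM, hv⟩ := hb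
  exact ⟨fun δ _ => ⟨M, hM, fun r _ => hv r⟩,
    fun r _ => ⟨M.toNNReal, fun s _ => (hv s).trans (ENNReal.coe_toNNReal hM).ge⟩⟩

/-- **Near-minimiser transfer across the hard wall for bounded pair potentials** — the third
hypothesis of `stub_hardWallLimit_aux`, at every density (`ρ₁ = 1` is nominal), eventually in `N`:
with `L = sideLength ρ' N`, for every Dirichlet slack `δ' > 0` and `ε > 0` there are `t₀` and
`δ₀ > 0` such that every `δ₀`-near-minimiser of `H_t`, `t₀ ≤ t ≤ ⊤`, is within `ε` in `L²` of a
`δ'`-near-minimiser of the Dirichlet cube of side `L/2`. [folklore] -/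
theorem hardWallTransfer_of_bounded : ∀ v : ℝ → ℝ≥0∞, IsRepulsiveFiniteRange v →
    (∃ M : ℝ≥0∞, M ≠ ⊤ ∧ ∀ r : ℝ, v r ≤ M) →
    ∃ ρ₁ : ℝ, 0 < ρ₁ ∧ ∀ ρ' : ℝ, 0 < ρ' → ρ' < ρ₁ → ∀ᶠ N : ℕ in atTop,
      ∀ δ' : ℝ≥0∞, 0 < δ' → ∀ ε : ℝ, 0 < ε → ∃ t₀ : ℝ≥0, ∃ δ₀ : ℝ≥0∞, 0 < δ₀ ∧
        ∀ t : ℝ≥0∞, (t₀ : ℝ≥0∞) ≤ t → ∀ Ψ : PeriodicTrialState N (sideLength ρ' N),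
          rampEnergy v (rimPot (sideLength ρ' N)) t Ψ ≤
              rampGroundStateEnergy v (rimPot (sideLength ρ' N)) t N (sideLength ρ' N) + δ₀ →
          ∃ Φ : TrialState N (sideLength ρ' N / 2),
            energy v Φ ≤ groundStateEnergy v N (sideLength ρ' N / 2) + δ' ∧
            ∫⁻ X, (‖Φ.ψ X - (cellN N (sideLength ρ' N)).indicator Ψ.ψ X‖₊ : ℝ≥0∞) ^ 2 ≤
              ENNReal.ofReal ε := by
  rintro v hv ⟨M, hM, hvM⟩
  obtain ⟨R, hR0, hvR⟩ := hv.exists_pos_range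
  obtain ⟨c₀, -, hprof⟩ := exists_isCutoffProfile
  refine ⟨1, one_pos, fun ρ' hρ' _ => ?_⟩
  filter_upwards [eventually_ge_atTop 1, (tendsto_sideLength_atTop hρ').eventually_ge_atTop (2 * R)]
    with N hN hNR
  set L : ℝ := sideLength ρ' N with hLdef
  have hL : 0 < L := sideLength_pos_of_pos hρ' hN
  have hRL : L / 2 + R ≤ L := by linarith
  have hlb := (locBdd_of_bounded ⟨M, hM, hvM⟩).2
  have hE : groundStateEnergy v N (L / 2) ≠ ⊤ :=
    groundStateEnergy_ne_top_of_locBdd N v _ hN (half_pos hL) hv.1 hlb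
  intro δ' hδ' ε hε
  -- the real slack `d = min δ' 1` and the energy scale `K = E₀^D + 1`
  set δ₁ : ℝ≥0∞ := min δ' 1 with hδ₁
  have hδ₁top : δ₁ ≠ ⊤ := ne_top_of_le_ne_top ENNReal.one_ne_top (min_le_right _ _)
  have hδ₁0 : δ₁ ≠ 0 := (lt_min hδ' one_pos).ne'
  set d : ℝ := δ₁.toReal with hd_def
  have hd : 0 < d := ENNReal.toReal_pos hδ₁0 hδ₁top
  have hd1 : d ≤ 1 := by
    have := ENNReal.toReal_mono ENNReal.one_ne_top (min_le_right δ' 1)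
    rwa [ENNReal.toReal_one] at this
  have hdδ : ENNReal.ofReal d ≤ δ' := by
    rw [hd_def, ENNReal.ofReal_toReal hδ₁top]
    exact min_le_left _ _
  set K : ℝ := (groundStateEnergy v N (L / 2)).toReal + 1 with hKdef
  have hK1 : 1 ≤ K := by rw [hKdef]; linarith [ENNReal.toReal_nonneg (a := groundStateEnergy v N (L / 2))]
  have hK0 : 0 ≤ K := by linarith
  have hKE : groundStateEnergy v N (L / 2) + 1 ≤ ENNReal.ofReal K := by
    rw [hKdef, ENNReal.ofReal_add ENNReal.toReal_nonneg zero_le_one, ENNReal.ofReal_toReal hE,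
      ENNReal.ofReal_one]
  -- the small parameter
  obtain ⟨h, hh, h16, hhalf, hP⟩ :=
    exists_hardWall_params N (c₀ := c₀) M.toReal hL hK1 hd hd1 hε
  have h8 : 8 * h < L := by linarith
  set η : ℝ := d / (16 * K) with hη
  have hη0 : 0 < η := by rw [hη]; positivity
  set T₀ : ℝ := K / h ^ 3 with hT₀
  have hT₀0 : 0 < T₀ := by rw [hT₀]; positivity
  refine ⟨Real.toNNReal T₀, ENNReal.ofReal (d / 4), ENNReal.ofReal_pos.2 (by positivity), ?_⟩
  intro t ht Ψ hΨ
  -- the chain at these parameters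
  have hμ : h ^ 3 ≤ 1 / 2 := by nlinarith [pow_le_pow_left₀ hh.le hhalf 3]
  have hKT : K ≤ h ^ 3 * T₀ := by rw [hT₀]; field_simp; exact le_rfl
  have hq : (1 + 2 * h ^ 3) * (1 + η⁻¹) * (c₀ / (h / 2)) ^ 2 * (3 * h ^ 3) =
      (1 + 2 * h ^ 3) * (1 + η⁻¹) * (12 * c₀ ^ 2 * h) := by
    field_simp
    ring
  obtain ⟨hEd, hDε⟩ := hP η (d / 4) _ _ _ _ _ _ _ rfl rfl rfl rfl rfl rfl rfl rfl rfl
  obtain ⟨Φ, hΦE, hΦd⟩ := transfer_chain (N := N) hL hv.1 hM hvM hvR hRL hprof hKE hK0 hh h8 hη0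
    (by positivity : (0 : ℝ) ≤ h ^ 3) hμ (by positivity : (0 : ℝ) ≤ d / 4) (by linarith) hT₀0 hKT
    rfl rfl rfl rfl hq.symm rfl rfl rfl ht Ψ hΨ
  refine ⟨Φ, hΦE.trans ?_, hΦd.trans (ENNReal.ofReal_le_ofReal hDε.le)⟩
  gcongr
  exact (ENNReal.ofReal_le_ofReal hEd.le).trans hdδ

/-- **Stub (L) for BOUNDED repulsive finite-range pair potentials** — the registered statement of
`stub_hardWallLimit` under the single extra hypothesis `∃ M ≠ ⊤, ∀ r, v r ≤ M`: at fixed `N`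
(large), `limsup_{t → ∞} coreOcc v t N ρ' ≤ coreOcc v ⊤ N ρ'`. From `stub_hardWallLimit_aux`
(Dirichlet rigidity of stmt-9072 + the soft assembly) and `hardWallTransfer_of_bounded`.
[folklore] -/
theorem stub_hardWallLimit_bounded : ∀ v : ℝ → ℝ≥0∞, IsRepulsiveFiniteRange v → (∃ M : ℝ≥0∞, M ≠ ⊤ ∧ ∀ r : ℝ, v r ≤ M) → ∃ ρ₁ : ℝ, 0 < ρ₁ ∧ ∀ ρ' : ℝ, 0 < ρ' → ρ' < ρ₁ → ∀ᶠ N : ℕ in atTop, ∀ η : ℝ, 0 < η → ∃ t₀ : ℝ≥0, ∀ t : ℝ≥0, t₀ ≤ t → coreOcc v (t : ℝ≥0∞) N ρ' ≤ coreOcc v ⊤ N ρ' + ENNReal.ofReal η :=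
  fun v hv hb => stub_hardWallLimit_aux v hv (locBdd_of_bounded hb).1 (hardWallTransfer_of_bounded v hv hb)

end Summit.AtomisticToContinuum.BoseEinsteinCondensation.RimSqueeze

end
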